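import Literature.NumberTheory.Weil1964.ArchMetaplecticUnitarySplitting
import Literature.RepresentationTheory.KonnoKonno2007.JunctionVacuumSection
import Literature.RepresentationTheory.KonnoKonno2007.RealUnitaryKAK
import HarnessLib

/-!
# Strong continuity of the `det^{1/2}`-normalised Weil representation of `U(p, q)` at every real rank
# (the archimedean Weil datum of the pair `(U(p,q), U(r,s))`, first factor, hypothesis-free)

Topic `NumberTheory/Weil1964`; namespace `Literature.NumberTheory.Weil1964.UnitaryWeil`.  KERNEL ONLY:
theorems and one definition with body (`γV`, the phase maps of the first factor); no record, no hypothesis,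
no `sorry`.  Sequel of
`Literature.NumberTheory.Weil1964.ArchMetaplecticUnitarySplitting` (the HOMOMORPHISM
`weilHomV P Q R S : U(P,Q) →* Mp^𝓢(𝕎)` over `g ↦ ι𝕎 (g, 1)`, its operator form `weilRepV`, vacuum coefficient
`C(weilHomV g) = (det d(g ⊗ 1))⁻¹ ≠ 0`, continuous in `g`).

THE RESULT (w1): **`(g, f) ↦ weilRepV g f` is jointly continuous `U(P,Q) × 𝓢(ℝ^{DPIdx}) → 𝓢(ℝ^{DPIdx})`**
(`continuous_uncurry_weilRepV`), hence `weilRepV` is an `IsArchWeilDatum` over `ι𝕎 ∘ inl`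
(`isArchWeilDatum_weilRepV`) — at EVERY signature `(|P|, |Q|)` and real rank, with no cited input.

THE PROOF uses no vacuum-normalised section and no cocycle computation: since `weilRepV` IS a homomorphism and
its vacuum COEFFICIENT is an explicit continuous nowhere-zero function, Schur's remark [Folland1989, p. 156]
identifies it with the tree's explicit jointly continuous implementer families up to a CONTINUOUS scalar read off at
the vacuum (§1 `continuous_uncurry_of_vacCoeffS`): on the maximal compact `K = U(P) × U(Q)` with Folland's `μ₀`
(`unitaryOpPi`, Prop. (4.39); §2), on each hyperbolic one-parameter subgroup `a^{(p₀,q₀)}_t` with the boost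
implementers `hypOp` of `JunctionHyperbolicFamily` (§3); products of commuting planar boosts `hypA` by the
homomorphism property (§4); and the word map `(k₁, t, k₂) ↦ k₁ a_t k₂` of the Cartan decomposition `U(P,Q) = KAK`
at arbitrary real rank is a proper surjection [Knapp2002, Thm 7.39] (`RealUnitaryKAK.isProperMap_kakMapA`,
`kakMapA_surjective`), along which joint continuity descends (§5, `continuous_uncurry_of_isProperMap`).

## References

* [Folland1989] G. B. Folland, *Harmonic Analysis in Phase Space*, Princeton UP 1989, §4.2 (4.23)–(4.24), the
  Schur remark p. 156, Prop. (4.39).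
* [Knapp2002] A. W. Knapp, *Lie Groups Beyond an Introduction*, 2nd ed., Birkhäuser 2002, Thm 7.39.
* [Kudla1994] S. S. Kudla, Israel J. Math. 87 (1994), §5; [KonnoKonno2007] Kyushu J. Math. 61 (2007), §3.1–§3.3.
-/

set_option autoImplicit false

noncomputable section

open Matrix Complex MeasureTheory SchwartzMap
open scoped ComplexConjugate

namespace Literature.NumberTheory.Weil1964

open Literature.RepresentationTheory.KonnoKonno2007 Literature.RepresentationTheory.KonnoKonno2007.RealDualPair
open Literature.NumberTheory.Automorphic Literature.NumberTheory.Automorphic.UnitaryGroup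
open Literature.Analysis.SegalBargmann Literature.RepresentationTheory.HeisenbergGroup
open MpS UnitaryBall

variable {σ : Type*} [Fintype σ] [DecidableEq σ]

local notation "SR" σ => SchwartzMap (σ → ℝ) ℂ
local notation "PV" σ => (σ → ℝ) × (σ → ℝ)

/-! ## 1. Schur with vacuum coefficients: joint continuity transfers along implementer families -/

/-- **Schur with coefficients.**  If `A x` and `W x` implement the same phase maps, `C(W x) ≠ 0` everywhere,
`(x, f) ↦ W x f` is jointly continuous and `x ↦ C(A x)` is continuous, then `A x = (C(A x)/C(W x)) • W x` and
`(x, f) ↦ A x f` is jointly continuous. [cite: Folland1989, §4.2, the Schur remark p. 156] -/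
theorem continuous_uncurry_of_vacCoeffS {X : Type*} [TopologicalSpace X] {γ : X → PhaseMap σ}
    {A W : X → ((SR σ) →L[ℂ] SR σ)} (hA : ∀ x, IsImplementerS (γ x) (A x)) (hW : ∀ x, IsImplementerS (γ x) (W x))
    (hW0 : ∀ x, vacCoeffS (W x) ≠ 0) (hAv : Continuous fun x => vacCoeffS (A x))
    (hWc : Continuous fun p : X × SR σ => W p.1 p.2) : Continuous fun p : X × SR σ => A p.1 p.2 := by
  have key : ∀ x, A x = (vacCoeffS (A x) / vacCoeffS (W x)) • W x := fun x => by
    obtain ⟨c, -, hcA⟩ := (hW x).exists_eq_smul (hA x)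
    have hv : vacCoeffS (A x) = c * vacCoeffS (W x) := by rw [hcA, vacCoeffS_smul]
    rw [hv, mul_div_assoc, div_self (hW0 x), mul_one]
    exact hcA
  have hWv : Continuous fun x => vacCoeffS (W x) :=
    continuous_vacCoeffS (hWc.comp (f := fun x : X => (x, (hermitePi 0 : SR σ)))
      (continuous_id.prodMk continuous_const))
  have h : (fun p : X × SR σ => A p.1 p.2) = fun p => (vacCoeffS (A p.1) / vacCoeffS (W p.1)) • W p.1 p.2 := by
    funext p
    calc A p.1 p.2 = ((vacCoeffS (A p.1) / vacCoeffS (W p.1)) • W p.1) p.2 := by rw [← key p.1]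
      _ = (vacCoeffS (A p.1) / vacCoeffS (W p.1)) • W p.1 p.2 := rfl
  rw [h]
  exact ((hAv.comp continuous_fst).div (hWv.comp continuous_fst) fun p => hW0 p.1).smul hWc

omit [DecidableEq σ] in
/-- An element of `Mp^𝓢(W)` implements its own symplectic projection (membership, unfolded).
[cite: Folland1989, §4.2 (4.23)] -/
theorem _root_.Literature.NumberTheory.Weil1964.MpS.isImplementerS_self (x : MpS σ) :
    IsImplementerS (⇑((proj x).1 : (PV σ) ≃ₗ[ℝ] PV σ))
      ((x.1.2 : (SR σ) ≃L[ℂ] SR σ) : (SR σ) →L[ℂ] SR σ) :=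
  ⟨((MpS.mem_iff_covariant _).1 x.2).1, ((MpS.mem_iff_covariant _).1 x.2).2⟩

/-- A vacuum-fixing operator has non-zero vacuum coefficient (`= ‖k₀‖²`). [cite: Folland1989, Prop. (4.39)] -/
theorem vacCoeffS_ne_zero_of_apply_hermitePi_zero {W : (SR σ) →L[ℂ] SR σ} (h : W (hermitePi 0) = hermitePi 0) :
    vacCoeffS W ≠ 0 := by
  rw [vacCoeffS_of_apply_hermitePi_zero h]
  exact vacL2_norm_sq_ne_zero

namespace UnitaryWeil

variable {P Q R S : Type*} [Fintype P] [DecidableEq P] [Fintype Q] [DecidableEq Q] [Fintype R] [DecidableEq R]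
  [Fintype S] [DecidableEq S]

/-- `weilHomV g` (as an operator) implements the phase map of `ι𝕎 (g, 1)`. [cite: Folland1989, §4.2 (4.23)] -/
theorem isImplementerS_weilHomV (g : UForm P Q) :
    IsImplementerS (⇑((ι𝕎 P Q R S (g, 1)).1 : (PV (DPIdx P Q R S)) ≃ₗ[ℝ] PV (DPIdx P Q R S)))
      (((weilHomV P Q R S g).1.2 : (SR (DPIdx P Q R S)) ≃L[ℂ] SR (DPIdx P Q R S)) :
        (SR (DPIdx P Q R S)) →L[ℂ] SR (DPIdx P Q R S)) := by
  have h := MpS.isImplementerS_self (weilHomV P Q R S g)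
  rwa [proj_weilHomV] at h

/-- the vacuum coefficient of the operator of `weilHomV g` is `C(weilHomV g)`, continuous in `g`.
[cite: Folland1989, §4.2 (4.36)] -/
theorem continuous_vacCoeffS_weilHomV :
    Continuous fun g : UForm P Q => vacCoeffS (((weilHomV P Q R S g).1.2 :
      (SR (DPIdx P Q R S)) ≃L[ℂ] SR (DPIdx P Q R S)) : (SR (DPIdx P Q R S)) →L[ℂ] SR (DPIdx P Q R S)) :=
  continuous_vac_weilHomV

/-! ## 2. The maximal compact `K = U(P) × U(Q)`: Folland's `μ₀` -/

variable (P Q R S) in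
/-- The phase maps of the first factor: `γV g = ⇑ι𝕎(g, 1)` on `ℝ^{DPIdx} × ℝ^{DPIdx}`. [cite: KonnoKonno2007, §3.1 (3.1)] -/
def γV (g : UForm P Q) : PhaseMap (DPIdx P Q R S) :=
  ⇑((ι𝕎 P Q R S (g, 1)).1 : (PV (DPIdx P Q R S)) ≃ₗ[ℝ] PV (DPIdx P Q R S))

/-- Unfolding `γV`. [cite: KonnoKonno2007, §3.1 (3.1)] -/
theorem γV_apply (g : UForm P Q) (pq : PV (DPIdx P Q R S)) :
    γV P Q R S g pq = ((ι𝕎 P Q R S (g, 1)).1 : (PV (DPIdx P Q R S)) ≃ₗ[ℝ] PV (DPIdx P Q R S)) pq := rfl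

/-- `weilHomV g` implements `γV g`. [cite: Folland1989, §4.2 (4.23)] -/
theorem isImplementerS_weilHomV' (g : UForm P Q) :
    IsImplementerS (γV P Q R S g)
      (((weilHomV P Q R S g).1.2 : (SR (DPIdx P Q R S)) ≃L[ℂ] SR (DPIdx P Q R S)) :
        (SR (DPIdx P Q R S)) →L[ℂ] SR (DPIdx P Q R S)) :=
  isImplementerS_weilHomV g

/-- `κ (k, 1) = (kV k, 1)`. [cite: KonnoKonno2007, §3.1] -/
theorem κ_inl_one (k : KV P Q) : κ P Q R S ((k, (1 : KV R S)) : DPK P Q R S) = (UForm.kV P Q k, 1) :=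
  Prod.ext rfl (map_one (UForm.kV R S))

/-- On `K`, `γV (kV k)` is the realified block unitary `diag(k̄₁, k₂) ⊗ 1_W` of the tree's `dualPairι`.
[cite: KonnoKonno2007, §3.1; Folland1989, Prop. (4.39)] -/
theorem γV_kV (k : KV P Q) (pq : PV (DPIdx P Q R S)) :
    γV P Q R S (UForm.kV P Q k) pq = realify (dualPairι ((k, (1 : KV R S)) : DPK P Q R S)) pq := by
  have h := ι𝕎_κ_apply R S ((k, (1 : KV R S)) : DPK P Q R S) pq
  rw [κ_inl_one] at h
  exact h

/-- Folland's `μ₀(diag(k̄₁, k₂) ⊗ 1)` implements `γV (kV k)`. [cite: Folland1989, Prop. (4.39)] -/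
theorem isImplementerS_unitaryOpPi_kV (k : KV P Q) :
    IsImplementerS (γV P Q R S (UForm.kV P Q k)) (unitaryOpPi (dualPairι ((k, (1 : KV R S)) : DPK P Q R S))) :=
  isImplementerS_unitaryOpPi (γ := γV P Q R S) (κ := UForm.kV P Q)
    (fun k : KV P Q => dualPairι ((k, (1 : KV R S)) : DPK P Q R S)) γV_kV k

/-- On `K`: `(k, f) ↦ weilRepV (kV k) f` is jointly continuous (`weilRepV (kV k) = C · μ₀(diag(k̄₁, k₂) ⊗ 1)`).
[cite: Folland1989, Prop. (4.39); KonnoKonno2007, §3.1] -/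
theorem continuous_uncurry_weilRepV_kV :
    Continuous fun x : KV P Q × SR (DPIdx P Q R S) => weilRepV P Q R S (UForm.kV P Q x.1) x.2 := by
  have hW : Continuous fun x : KV P Q × SR (DPIdx P Q R S) =>
      unitaryOpPi (dualPairι ((x.1, (1 : KV R S)) : DPK P Q R S)) x.2 :=
    continuous_unitaryOpPi_uncurry.comp
      (f := fun x : KV P Q × SR (DPIdx P Q R S) => (dualPairι ((x.1, (1 : KV R S)) : DPK P Q R S), x.2))
      ((continuous_dualPairι.comp (f := fun x : KV P Q × SR (DPIdx P Q R S) => ((x.1, (1 : KV R S)) : DPK P Q R S))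
        (continuous_fst.prodMk continuous_const)).prodMk continuous_snd)
  exact continuous_uncurry_of_vacCoeffS (γ := fun k : KV P Q => γV P Q R S (UForm.kV P Q k))
    (A := fun k => ((weilHomV P Q R S (UForm.kV P Q k)).1.2 :
      (SR (DPIdx P Q R S)) ≃L[ℂ] SR (DPIdx P Q R S)))
    (W := fun k => unitaryOpPi (dualPairι ((k, (1 : KV R S)) : DPK P Q R S)))
    (fun k => isImplementerS_weilHomV' _) isImplementerS_unitaryOpPi_kV
    (fun k => vacCoeffS_ne_zero_of_apply_hermitePi_zero (unitaryOpPi_hermitePi_zero _))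
    (continuous_vacCoeffS_weilHomV.comp (f := fun k : KV P Q => UForm.kV P Q k) UForm.continuous_kV) hW

/-- composition form of `continuous_uncurry_weilRepV_kV`. [cite: Folland1989, Prop. (4.39)] -/
theorem Continuous.weilRepV_kV {X : Type*} [TopologicalSpace X] {φ : X → KV P Q} {ψ : X → SR (DPIdx P Q R S)}
    (hφ : Continuous φ) (hψ : Continuous ψ) :
    Continuous fun x => weilRepV P Q R S (UForm.kV P Q (φ x)) (ψ x) :=
  (continuous_uncurry_weilRepV_kV (R := R) (S := S)).comp (f := fun x => (φ x, ψ x)) (hφ.prodMk hψ)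

/-! ## 3. One hyperbolic plane: the boosts `a^{(p₀,q₀)}_t` against `hypOp` -/

/-- On a boost one-parameter subgroup: `(t, f) ↦ weilRepV (hypV p₀ q₀ t) f` is jointly continuous
(`weilRepV (hypV t) = [C(weilHomV (hypV t)) / C(hypOp t)] · hypOp t`). [cite: Folland1989, §4.2 (4.24), p. 156] -/
theorem continuous_uncurry_weilRepV_hypV (p₀ : P) (q₀ : Q) :
    Continuous fun p : ℝ × SR (DPIdx P Q R S) => weilRepV P Q R S (hypV p₀ q₀ p.1) p.2 :=
  continuous_uncurry_of_vacCoeffS (γ := fun t : ℝ =>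
      (⇑((ι𝕎 P Q R S ((hypV p₀ q₀ t : UForm P Q), (1 : UForm R S))).1 :
        (PV (DPIdx P Q R S)) ≃ₗ[ℝ] PV (DPIdx P Q R S)) : PhaseMap (DPIdx P Q R S)))
    (A := fun t => ((weilHomV P Q R S (hypV p₀ q₀ t)).1.2 :
      (SR (DPIdx P Q R S)) ≃L[ℂ] SR (DPIdx P Q R S)))
    (W := fun t => hypOp R S p₀ q₀ t)
    (fun _ => isImplementerS_weilHomV _) (isImplementerS_hypOp R S p₀ q₀) (vacCoeffS_hypOp_ne_zero R S p₀ q₀)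
    (continuous_vacCoeffS_weilHomV.comp (f := fun t : ℝ => (hypV p₀ q₀ t : UForm P Q)) (continuous_hypV p₀ q₀))
    (continuous_hypOp_uncurry R S p₀ q₀)

/-- composition form of `continuous_uncurry_weilRepV_hypV`. [cite: Folland1989, §4.2 (4.24)] -/
theorem Continuous.weilRepV_hypV {X : Type*} [TopologicalSpace X] (p₀ : P) (q₀ : Q) {φ : X → ℝ}
    {ψ : X → SR (DPIdx P Q R S)} (hφ : Continuous φ) (hψ : Continuous ψ) :
    Continuous fun x => weilRepV P Q R S (hypV p₀ q₀ (φ x)) (ψ x) :=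
  (continuous_uncurry_weilRepV_hypV (R := R) (S := S) p₀ q₀).comp (f := fun x => (φ x, ψ x)) (hφ.prodMk hψ)

/-! ## 4. Products of commuting planar boosts (the split torus at arbitrary real rank) -/

section Torus

variable {ι : Type*} [Fintype ι] {p : ι → P} {q : ι → Q} (hp : Function.Injective p) (hq : Function.Injective q)

omit [Fintype ι] in
/-- On the split torus `a_t = ∏_{j ∈ T} a^{(p j, q j)}_{t_j}`: `(t, f) ↦ weilRepV (hypA T t) f` is jointly continuous —
factor by factor, `weilRepV` being a homomorphism. [cite: Knapp2002, Thm 7.39; Folland1989, §4.2 (4.24)] -/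
theorem continuous_uncurry_weilRepV_hypA (T : Finset ι) :
    Continuous fun x : (ι → ℝ) × SR (DPIdx P Q R S) => weilRepV P Q R S (hypA hp hq T x.1) x.2 := by
  classical
  induction T using Finset.induction_on with
  | empty =>
    simp only [hypA_empty, map_one, Module.End.one_apply]
    exact continuous_snd
  | insert j T hj ih =>
    have h : (fun x : (ι → ℝ) × SR (DPIdx P Q R S) => weilRepV P Q R S (hypA hp hq (insert j T) x.1) x.2) =
        fun x => weilRepV P Q R S (hypV (p j) (q j) (x.1 j)) (weilRepV P Q R S (hypA hp hq T x.1) x.2) := by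
      funext x
      rw [hypA_insert hp hq hj, map_mul, Module.End.mul_apply]
    rw [h]
    exact Continuous.weilRepV_hypV (p j) (q j) ((continuous_apply j).comp continuous_fst) ih

/-! ## 5. Descent along the proper surjection `K × ℝ^ι × K → U(P,Q)` -/

/-- Along the `KAK` word map: `((k₁, t, k₂), f) ↦ weilRepV (k₁ a_t k₂) f` is jointly continuous.
[cite: Knapp2002, Thm 7.39; Folland1989, §4.2 p. 156] -/
theorem continuous_uncurry_weilRepV_kakMapA :
    Continuous fun x : (KV P Q × (ι → ℝ) × KV P Q) × SR (DPIdx P Q R S) =>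
      weilRepV P Q R S (kakMapA hp hq x.1) x.2 := by
  have h : (fun x : (KV P Q × (ι → ℝ) × KV P Q) × SR (DPIdx P Q R S) => weilRepV P Q R S (kakMapA hp hq x.1) x.2) =
      fun x => weilRepV P Q R S (UForm.kV P Q x.1.1)
        (weilRepV P Q R S (hypA hp hq Finset.univ x.1.2.1) (weilRepV P Q R S (UForm.kV P Q x.1.2.2) x.2)) := by
    funext x
    rw [kakMapA, map_mul, map_mul, Module.End.mul_apply, Module.End.mul_apply]
  rw [h]
  have h3 : Continuous fun x : (KV P Q × (ι → ℝ) × KV P Q) × SR (DPIdx P Q R S) =>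
      weilRepV P Q R S (UForm.kV P Q x.1.2.2) x.2 :=
    Continuous.weilRepV_kV (continuous_snd.comp (continuous_snd.comp continuous_fst)) continuous_snd
  have h2 : Continuous fun x : (KV P Q × (ι → ℝ) × KV P Q) × SR (DPIdx P Q R S) =>
      weilRepV P Q R S (hypA hp hq Finset.univ x.1.2.1) (weilRepV P Q R S (UForm.kV P Q x.1.2.2) x.2) :=
    (continuous_uncurry_weilRepV_hypA (R := R) (S := S) hp hq Finset.univ).comp
      (f := fun x : (KV P Q × (ι → ℝ) × KV P Q) × SR (DPIdx P Q R S) =>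
        (x.1.2.1, weilRepV P Q R S (UForm.kV P Q x.1.2.2) x.2))
      ((continuous_fst.comp (continuous_snd.comp continuous_fst)).prodMk h3)
  exact Continuous.weilRepV_kV (continuous_fst.comp continuous_fst) h2

include hp hq in
/-- **(w1), framed form**: for a frame of disjoint hyperbolic planes exhausting `P` or `Q`,
`(g, f) ↦ weilRepV g f` is jointly continuous. [cite: Knapp2002, Thm 7.39; Folland1989, §4.2 p. 156] -/
theorem continuous_uncurry_weilRepV_of_frame (hpq : Function.Surjective p ∨ Function.Surjective q) :
    Continuous fun x : UForm P Q × SR (DPIdx P Q R S) => weilRepV P Q R S x.1 x.2 :=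
  continuous_uncurry_of_isProperMap (isProperMap_kakMapA hp hq) (kakMapA_surjective hp hq hpq)
    (F := fun g f => weilRepV P Q R S g f) (continuous_uncurry_weilRepV_kakMapA hp hq)

end Torus

/-- **(w1) JOINT CONTINUITY of the Weil representation of `U(P,Q)`**: `(g, f) ↦ weilRepV g f` is continuous
`U(P,Q) × 𝓢 → 𝓢`, at every signature and real rank (the frame is chosen internally).
[cite: Folland1989, §4.2 p. 156, Prop. (4.39); Knapp2002, Thm 7.39] -/
theorem continuous_uncurry_weilRepV :
    Continuous fun x : UForm P Q × SR (DPIdx P Q R S) => weilRepV P Q R S x.1 x.2 := by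
  rcases le_total (Fintype.card Q) (Fintype.card P) with h | h
  · obtain ⟨e⟩ := Function.Embedding.nonempty_of_card_le h
    exact continuous_uncurry_weilRepV_of_frame (p := e) (q := id) e.injective Function.injective_id
      (Or.inr Function.surjective_id)
  · obtain ⟨e⟩ := Function.Embedding.nonempty_of_card_le h
    exact continuous_uncurry_weilRepV_of_frame (p := id) (q := e) Function.injective_id e.injective
      (Or.inl Function.surjective_id)

/-- **(w1)**: every orbit map `g ↦ weilRepV g f` is continuous into `𝓢`. [cite: Folland1989, §4.2 p. 156] -/
theorem continuous_weilRepV_apply (f : SR (DPIdx P Q R S)) :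
    Continuous fun g : UForm P Q => weilRepV P Q R S g f :=
  continuous_uncurry_weilRepV.comp (f := fun g : UForm P Q => (g, f)) (continuous_id.prodMk continuous_const)

/-- the operator of `weilHomV g` applied to `f`, continuous in `g`. [cite: Folland1989, §4.2 p. 156] -/
theorem continuous_weilHomV_apply (f : SR (DPIdx P Q R S)) :
    Continuous fun g : UForm P Q => (weilHomV P Q R S g).1.2 f :=
  continuous_weilRepV_apply f

variable (P Q R S) in
/-- **THE ARCHIMEDEAN WEIL DATUM OF `U(P,Q)`** (first member of the pair `(U(P,Q), U(R,S))`, character class fixed by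
the `det^{1/2}` normalisation): `weilRepV` satisfies (w1) strong continuity, (w2) Heisenberg covariance over
`ι𝕎 ∘ inl`, (w2′) unitary lifts — HYPOTHESIS-FREE, at every signature and real rank.
[cite: Kudla1994, §5; Paul1998, §1.2 (1.2.1)–(1.2.2); KonnoKonno2007, §3.3; Folland1989, §4.2] -/
theorem isArchWeilDatum_weilRepV :
    IsArchWeilDatum ((ι𝕎 P Q R S).comp (MonoidHom.inl (UForm P Q) (UForm R S))) (weilRepV P Q R S) where
  continuous_apply := continuous_weilRepV_apply
  covariant := isPhaseCovariantS_weilRepV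
  exists_lift := exists_lift_weilRepV

end UnitaryWeil

end Literature.NumberTheory.Weil1964
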